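import Mathlib
import Summits.Ventures.PercRepro2.LocRows
import Summits.Ventures.PercRepro2.SwRow
import Summits.Ventures.PercRepro2.SwOut
import Summits.Ventures.PercRepro2.SwAllRow
import Summits.Ventures.PercRepro2.SwOutAll
import Summits.Ventures.PercRepro2.SwOutReducible
import Summits.Ventures.PercRepro2.SwOutJunction
import Summits.Ventures.PercRepro2.SwOutJunctionRegion
import Summits.Ventures.PercRepro2.SwOutJunctionSw
import Summits.Ventures.PercRepro2.SwOutJunctionH1Defs
import Summits.Ventures.PercRepro2.SwOutJunctionH1Sw
import Summits.Ventures.PercRepro2.SwOutEdgeJunctionKey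

/-!
# Row (SW) on every graph with one (H1) junction adjacent to `h` (blind cell PercRepro2,
night-4 g16, 2026-08-26; proofs/NIGHT4-G15.md §4 (Theorem A⁺), proofs/NIGHT4-G16.md §4)

Theorem A⁺ (`rigidOK_of_junctionH1Adj`) makes every (H1) single-junction region whose junction is
joined to `h` by exactly one edge a base region of the series reduction
(`reducible_of_junctionH1Adj`); with the region `{l}ᶜ` this is the rigid row 2′SW-ALL
(`swAll_of_junctionH1Adj`) and row (SW) (`sw_of_junctionH1Adj`) on every graph in which every
vertex other than `l, h, o` is joined to `l` or is one vertex `u ∉ N(l)` joined to `h` by ONE edge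
whose other neighbours satisfy the simple-arm hypothesis (H1) in `U = V ∖ {l}` — the adjacent
twin of `sw_of_junctionH1` (which needs `u ∉ N(h)`).
-/

namespace Summit.Ventures.PercRepro2

namespace LocRows

open Hull

variable {V : Type*} {E : Type*} [Fintype E] [DecidableEq E]

open scoped Classical

variable {ends : E → Sym2 V} {l h o u : V}

/-- A region with one (H1) junction adjacent to `h` (one h–u edge) is a base region of the series
reduction. -/
theorem reducible_of_junctionH1Adj {U : Set V} (hl : l ∉ U) (hloop_h : ∀ e, ends e ≠ s(h, h))
    (hloop_u : ∀ e, ends e ≠ s(u, u)) (hhu : h ≠ u) (hadj : ∃ e, ends e = s(h, u))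
    (hhu1 : ∀ e e', ends e = s(h, u) → ends e' = s(h, u) → e = e')
    (hout : ∀ x ∈ U, x ≠ h → x ≠ o → x ≠ u →
      (∃ e y, ends e = s(x, y) ∧ y ∉ U) ∨ (∀ e, x ∉ ends e))
    (hH1 : H1 ends U h u) : Reducible l h o ends U :=
  Reducible.base ends U fun ξ =>
    rigidOK_of_junctionH1Adj (ξ := ξ) hl hhu hloop_h hloop_u hadj hhu1 hout hH1

/-- **Row 2′SW-ALL on every graph with one (H1) junction adjacent to `h`**: every vertex other
than `l, h, o, u` is joined to `l`, `u ≠ l`, no loop at `h` or `u`, exactly one h–u edge, and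
(H1) in `{l}ᶜ`. -/
theorem swAll_of_junctionH1Adj (hlh : l ≠ h) (hloop_h : ∀ e, ends e ≠ s(h, h))
    (hloop_u : ∀ e, ends e ≠ s(u, u)) (hhu : h ≠ u) (hadj : ∃ e, ends e = s(h, u))
    (hhu1 : ∀ e e', ends e = s(h, u) → ends e' = s(h, u) → e = e')
    (hH1 : H1 ends ({l}ᶜ) h u)
    (hjoin : ∀ x, x ≠ l → x ≠ h → x ≠ o → x ≠ u → ∃ e, ends e = s(x, l)) : SwAll ends l h o := by
  refine swAll_of_reducible l h o hlh
    (reducible_of_junctionH1Adj (by simp) hloop_h hloop_u hhu hadj hhu1 ?_ hH1)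
  intro x hx hxh hxo hxu
  obtain ⟨e, he⟩ := hjoin x (by simpa using hx) hxh hxo hxu
  exact Or.inl ⟨e, l, he, by simp⟩

/-- **Row (SW) on every graph with one (H1) junction adjacent to `h`** (see
`swAll_of_junctionH1Adj`). -/
theorem sw_of_junctionH1Adj (hlh : l ≠ h) (hloop_h : ∀ e, ends e ≠ s(h, h))
    (hloop_u : ∀ e, ends e ≠ s(u, u)) (hhu : h ≠ u) (hadj : ∃ e, ends e = s(h, u))
    (hhu1 : ∀ e e', ends e = s(h, u) → ends e' = s(h, u) → e = e')
    (hH1 : H1 ends ({l}ᶜ) h u)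
    (hjoin : ∀ x, x ≠ l → x ≠ h → x ≠ o → x ≠ u → ∃ e, ends e = s(x, l)) : Sw ends l h o :=
  sw_of_swAll ends (swAll_of_junctionH1Adj hlh hloop_h hloop_u hhu hadj hhu1 hH1 hjoin)

end LocRows

end Summit.Ventures.PercRepro2
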